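import Mathlib.Tactic.Ring
import Mathlib.Tactic.Linarith
import Mathlib.Tactic.Positivity
import Mathlib.Tactic.LinearCombination
import Mathlib.Data.Real.Basic
import HarnessLib
import Summits.HodgeConjecture.HodgeConjecture.Theorems.WeilClassTestSignLaw

/-!
# Conjecture N (hodge-weil ladder, GAPS G51b), format (4,2): the WALL FACTORISATION and the parity half of the sign law

Prover 2, generation 12 (note `run/shared/lean/b2b/hodge-weil/b2b-hweil-pv2-g12/VERTEX-FORM-G12.md` §3). Setting (`CONJECTURE-N.md` §1,
real charges, format (4,2)): E-charges `u₁..u₄`, F-charges `v₁, v₂`, centred (`Σu = Σv`, so the mass-2 signed mean vanishes and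
`S_u = Σu² − v₁² − v₂²` is the centred second charge moment) and pure in the charge-only sense (P4) `Σu³ = Σv³`.
Generation 11 found EMPIRICALLY (`CROSS-MAX-G11.md` §2.4, 432/432 samples) that exactly two of the four 'wall functions' `2u_e² − S_u`
are positive. Here: (1) `σ·S_u = −2e₃(u)` with `σ = Σu_e`, `e₃` the third elementary symmetric function of the E-charges
(`sigma_mul_Su`); (2) each wall function FACTORISES: `σ(2u_e² − S_u) = 2∏_{e' ≠ e}(u_e + u_{e'})` (`WeilClassTestSignLaw.wall₁..₄`,
landed first in the companion file and imported here); hence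
(3) `∏_e (2u_e² − S_u) = 16 ∏_{e<e'} (u_e + u_{e'})² / σ⁴ ≥ 0` — the number of positive wall functions is EVEN (`wall_product_nonneg`,
with the degenerate case `σ = 0` in `wall_product_nonneg_of_sigma_zero`); (4) the other input of the sign law: in the vertex gauge the
purity equation (P2) reads `Σ_k s_k Z_k² = ½ S_u Σ_k s_k` (`s_k = ε_k(y_k − yV)` the heights over any level `yV`), so a dominant
configuration satisfying (P2) has `S_u ≥ 0` (`format42_P2_vertex_identity`, `format42_Su_nonneg_of_dominant_P2`); in particular the
theorem `format42_G0_nonneg_of_Su_nonpos` of `WeilClassTestVertexForm42` meets the pure dominant locus only in `S_u = 0`.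
Pure algebra; nothing here is a rung, a door edge or a cited fact; no statement of Markman's papers is used. New cell result ⇒ Summits/.
-/

set_option linter.dupNamespace false

namespace Summit.HodgeConjecture.HodgeConjecture.WeilClassTestWallFactorisation

/-- (1) For centred, (P4)-pure real charges in format (4,2): `(Σu)·S_u = −2e₃(u)`. -/
theorem sigma_mul_Su (u₁ u₂ u₃ u₄ v₁ v₂ : ℝ) (h1 : u₁ + u₂ + u₃ + u₄ = v₁ + v₂)
    (h3 : u₁ ^ 3 + u₂ ^ 3 + u₃ ^ 3 + u₄ ^ 3 = v₁ ^ 3 + v₂ ^ 3) :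
    (u₁ + u₂ + u₃ + u₄) * (u₁ ^ 2 + u₂ ^ 2 + u₃ ^ 2 + u₄ ^ 2 - v₁ ^ 2 - v₂ ^ 2)
      = -2 * (u₁ * u₂ * u₃ + u₁ * u₂ * u₄ + u₁ * u₃ * u₄ + u₂ * u₃ * u₄) := by
  linear_combination
    (((u₁ + u₂ + u₃ + u₄) ^ 2 + (u₁ + u₂ + u₃ + u₄) * (v₁ + v₂) + (v₁ + v₂) ^ 2) / 3 - (v₁ ^ 2 + v₂ ^ 2)) * h1
      + (2 / 3) * h3

/- (2) THE WALL FACTORISATION `σ(2u_e² − S_u) = 2∏_{e'≠e}(u_e + u_{e'})` for `e = 1..4` is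
`Summit.HodgeConjecture.HodgeConjecture.WeilClassTestSignLaw.wall₁..₄` (landed first, p202582); it is used below by name. -/

/-- (3) PARITY HALF OF THE SIGN LAW (generic case `σ ≠ 0`): the product of the four wall functions is non-negative,
because `σ⁴ ∏_e(2u_e² − S_u) = 16 ∏_{e<e'}(u_e + u_{e'})²`. So the number of E-roots with `2u_e² > S_u` is even. -/
theorem wall_product_nonneg (u₁ u₂ u₃ u₄ v₁ v₂ : ℝ) (hσ : u₁ + u₂ + u₃ + u₄ ≠ 0) (h1 : u₁ + u₂ + u₃ + u₄ = v₁ + v₂)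
    (h3 : u₁ ^ 3 + u₂ ^ 3 + u₃ ^ 3 + u₄ ^ 3 = v₁ ^ 3 + v₂ ^ 3) :
    let Su : ℝ := u₁ ^ 2 + u₂ ^ 2 + u₃ ^ 2 + u₄ ^ 2 - v₁ ^ 2 - v₂ ^ 2
    0 ≤ (2 * u₁ ^ 2 - Su) * (2 * u₂ ^ 2 - Su) * (2 * u₃ ^ 2 - Su) * (2 * u₄ ^ 2 - Su) := by
  intro Su
  have w1 := WeilClassTestSignLaw.wall₁ u₁ u₂ u₃ u₄ v₁ v₂ h1 h3
  have w2 := WeilClassTestSignLaw.wall₂ u₁ u₂ u₃ u₄ v₁ v₂ h1 h3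
  have w3 := WeilClassTestSignLaw.wall₃ u₁ u₂ u₃ u₄ v₁ v₂ h1 h3
  have w4 := WeilClassTestSignLaw.wall₄ u₁ u₂ u₃ u₄ v₁ v₂ h1 h3
  have hσ4 : 0 < (u₁ + u₂ + u₃ + u₄) ^ 4 := by positivity
  have key : (u₁ + u₂ + u₃ + u₄) ^ 4 * ((2 * u₁ ^ 2 - Su) * (2 * u₂ ^ 2 - Su) * (2 * u₃ ^ 2 - Su) * (2 * u₄ ^ 2 - Su))
      = ((u₁ + u₂ + u₃ + u₄) * (2 * u₁ ^ 2 - Su)) * ((u₁ + u₂ + u₃ + u₄) * (2 * u₂ ^ 2 - Su))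
        * ((u₁ + u₂ + u₃ + u₄) * (2 * u₃ ^ 2 - Su)) * ((u₁ + u₂ + u₃ + u₄) * (2 * u₄ ^ 2 - Su)) := by ring
  have hnn : 0 ≤ (u₁ + u₂ + u₃ + u₄) ^ 4
      * ((2 * u₁ ^ 2 - Su) * (2 * u₂ ^ 2 - Su) * (2 * u₃ ^ 2 - Su) * (2 * u₄ ^ 2 - Su)) := by
    rw [key, w1, w2, w3, w4]
    have : 2 * ((u₁ + u₂) * (u₁ + u₃) * (u₁ + u₄)) * (2 * ((u₂ + u₁) * (u₂ + u₃) * (u₂ + u₄)))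
        * (2 * ((u₃ + u₁) * (u₃ + u₂) * (u₃ + u₄))) * (2 * ((u₄ + u₁) * (u₄ + u₂) * (u₄ + u₃)))
        = 16 * ((u₁ + u₂) * (u₁ + u₃) * (u₁ + u₄) * (u₂ + u₃) * (u₂ + u₄) * (u₃ + u₄)) ^ 2 := by ring
    rw [this]; positivity
  exact (mul_nonneg_iff_of_pos_left hσ4).mp hnn

/-- (3') The degenerate case `σ = 0`: then (P4) forces `(u₁+u₂)(u₁+u₃)(u₂+u₃) = 0`, the E-charges come in two opposite pairs,
the four wall functions coincide in pairs, and their product is a square. -/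
theorem wall_product_nonneg_of_sigma_zero (u₁ u₂ u₃ u₄ v₁ v₂ : ℝ) (hσ : u₁ + u₂ + u₃ + u₄ = 0)
    (h1 : u₁ + u₂ + u₃ + u₄ = v₁ + v₂) (h3 : u₁ ^ 3 + u₂ ^ 3 + u₃ ^ 3 + u₄ ^ 3 = v₁ ^ 3 + v₂ ^ 3) :
    let Su : ℝ := u₁ ^ 2 + u₂ ^ 2 + u₃ ^ 2 + u₄ ^ 2 - v₁ ^ 2 - v₂ ^ 2
    0 ≤ (2 * u₁ ^ 2 - Su) * (2 * u₂ ^ 2 - Su) * (2 * u₃ ^ 2 - Su) * (2 * u₄ ^ 2 - Su) := by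
  intro Su
  have hv : v₂ = -v₁ := by linarith
  have hu : u₄ = -(u₁ + u₂ + u₃) := by linarith
  have hprod : (u₁ + u₂) * ((u₁ + u₃) * (u₂ + u₃)) = 0 := by
    have h3' : u₁ ^ 3 + u₂ ^ 3 + u₃ ^ 3 + (-(u₁ + u₂ + u₃)) ^ 3 = v₁ ^ 3 + (-v₁) ^ 3 := by rw [← hu, ← hv]; exact h3
    linear_combination (-1 / 3 : ℝ) * h3'
  -- in each case two E-charges are opposite, hence so are the other two, and the product is a square
  have sq_case : ∀ a b c d : ℝ, a + b = 0 → c + d = 0 →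
      0 ≤ (2 * a ^ 2 - (a ^ 2 + b ^ 2 + c ^ 2 + d ^ 2 - v₁ ^ 2 - v₂ ^ 2))
        * (2 * b ^ 2 - (a ^ 2 + b ^ 2 + c ^ 2 + d ^ 2 - v₁ ^ 2 - v₂ ^ 2))
        * (2 * c ^ 2 - (a ^ 2 + b ^ 2 + c ^ 2 + d ^ 2 - v₁ ^ 2 - v₂ ^ 2))
        * (2 * d ^ 2 - (a ^ 2 + b ^ 2 + c ^ 2 + d ^ 2 - v₁ ^ 2 - v₂ ^ 2)) := by
    intro a b c d hab hcd
    have hb : b = -a := by linarith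
    have hd : d = -c := by linarith
    subst hb; subst hd
    have : (2 * a ^ 2 - (a ^ 2 + (-a) ^ 2 + c ^ 2 + (-c) ^ 2 - v₁ ^ 2 - v₂ ^ 2))
        * (2 * (-a) ^ 2 - (a ^ 2 + (-a) ^ 2 + c ^ 2 + (-c) ^ 2 - v₁ ^ 2 - v₂ ^ 2))
        * (2 * c ^ 2 - (a ^ 2 + (-a) ^ 2 + c ^ 2 + (-c) ^ 2 - v₁ ^ 2 - v₂ ^ 2))
        * (2 * (-c) ^ 2 - (a ^ 2 + (-a) ^ 2 + c ^ 2 + (-c) ^ 2 - v₁ ^ 2 - v₂ ^ 2))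
        = ((2 * a ^ 2 - (a ^ 2 + (-a) ^ 2 + c ^ 2 + (-c) ^ 2 - v₁ ^ 2 - v₂ ^ 2))
            * (2 * c ^ 2 - (a ^ 2 + (-a) ^ 2 + c ^ 2 + (-c) ^ 2 - v₁ ^ 2 - v₂ ^ 2))) ^ 2 := by ring
    rw [this]; positivity
  rcases mul_eq_zero.mp hprod with h12 | h'
  · exact sq_case u₁ u₂ u₃ u₄ h12 (by linarith)
  · rcases mul_eq_zero.mp h' with h13 | h23
    · have key := sq_case u₁ u₃ u₂ u₄ h13 (by linarith)
      have e : (2 * u₁ ^ 2 - Su) * (2 * u₂ ^ 2 - Su) * (2 * u₃ ^ 2 - Su) * (2 * u₄ ^ 2 - Su)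
          = (2 * u₁ ^ 2 - (u₁ ^ 2 + u₃ ^ 2 + u₂ ^ 2 + u₄ ^ 2 - v₁ ^ 2 - v₂ ^ 2))
            * (2 * u₃ ^ 2 - (u₁ ^ 2 + u₃ ^ 2 + u₂ ^ 2 + u₄ ^ 2 - v₁ ^ 2 - v₂ ^ 2))
            * (2 * u₂ ^ 2 - (u₁ ^ 2 + u₃ ^ 2 + u₂ ^ 2 + u₄ ^ 2 - v₁ ^ 2 - v₂ ^ 2))
            * (2 * u₄ ^ 2 - (u₁ ^ 2 + u₃ ^ 2 + u₂ ^ 2 + u₄ ^ 2 - v₁ ^ 2 - v₂ ^ 2)) := by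
        simp only [Su]; ring
      rw [e]; exact key
    · have key := sq_case u₂ u₃ u₁ u₄ h23 (by linarith)
      have e : (2 * u₁ ^ 2 - Su) * (2 * u₂ ^ 2 - Su) * (2 * u₃ ^ 2 - Su) * (2 * u₄ ^ 2 - Su)
          = (2 * u₂ ^ 2 - (u₂ ^ 2 + u₃ ^ 2 + u₁ ^ 2 + u₄ ^ 2 - v₁ ^ 2 - v₂ ^ 2))
            * (2 * u₃ ^ 2 - (u₂ ^ 2 + u₃ ^ 2 + u₁ ^ 2 + u₄ ^ 2 - v₁ ^ 2 - v₂ ^ 2))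
            * (2 * u₁ ^ 2 - (u₂ ^ 2 + u₃ ^ 2 + u₁ ^ 2 + u₄ ^ 2 - v₁ ^ 2 - v₂ ^ 2))
            * (2 * u₄ ^ 2 - (u₂ ^ 2 + u₃ ^ 2 + u₁ ^ 2 + u₄ ^ 2 - v₁ ^ 2 - v₂ ^ 2)) := by
        simp only [Su]; ring
      rw [e]; exact key

/-- (4) (P2) IN THE VERTEX GAUGE, format (4,2) (E-roots `1..4`, F-roots `5,6`): for ANY level `yV`, with heights `s_k = ε_k(y_k − yV)`,
`Σε Y_k Z_k² = Σ_k s_k Z_k² − ½ S_u Σ_k s_k` (`Y, Z` the mass-2 centred positions and charges) — a polynomial identity. -/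
theorem format42_P2_vertex_identity (y₁ y₂ y₃ y₄ y₅ y₆ u₁ u₂ u₃ u₄ u₅ u₆ yV : ℝ) :
    let yb : ℝ := (y₁ + y₂ + y₃ + y₄ - y₅ - y₆) / 2
    let ub : ℝ := (u₁ + u₂ + u₃ + u₄ - u₅ - u₆) / 2
    let Sz : ℝ := (u₁ - ub) ^ 2 + (u₂ - ub) ^ 2 + (u₃ - ub) ^ 2 + (u₄ - ub) ^ 2 - ((u₅ - ub) ^ 2 + (u₆ - ub) ^ 2)
    let P2 : ℝ := (y₁ - yb) * (u₁ - ub) ^ 2 + (y₂ - yb) * (u₂ - ub) ^ 2 + (y₃ - yb) * (u₃ - ub) ^ 2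
      + (y₄ - yb) * (u₄ - ub) ^ 2 - ((y₅ - yb) * (u₅ - ub) ^ 2 + (y₆ - yb) * (u₆ - ub) ^ 2)
    let A : ℝ := (y₁ - yV) + (y₂ - yV) + (y₃ - yV) + (y₄ - yV) + (yV - y₅) + (yV - y₆)
    P2 = (y₁ - yV) * (u₁ - ub) ^ 2 + (y₂ - yV) * (u₂ - ub) ^ 2 + (y₃ - yV) * (u₃ - ub) ^ 2 + (y₄ - yV) * (u₄ - ub) ^ 2
          + (yV - y₅) * (u₅ - ub) ^ 2 + (yV - y₆) * (u₆ - ub) ^ 2 - 1 / 2 * Sz * A := by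
  intro yb ub Sz P2 A
  simp only [A, P2, Sz, ub, yb]
  ring

/-- (4') Hence a DOMINANT configuration (`y_e ≥ yV ≥ y_f` for some level `yV`) satisfying (P2) has `S_u · Σ_k s_k = 2 Σ_k s_k Z_k² ≥ 0`;
so `S_u ≥ 0` as soon as one root is off the level `yV`, and pure pairwise-ample configurations never have `S_u < 0`. -/
theorem format42_Su_nonneg_of_dominant_P2 (y₁ y₂ y₃ y₄ y₅ y₆ u₁ u₂ u₃ u₄ u₅ u₆ yV : ℝ)
    (h₁ : yV ≤ y₁) (h₂ : yV ≤ y₂) (h₃ : yV ≤ y₃) (h₄ : yV ≤ y₄) (h₅ : y₅ ≤ yV) (h₆ : y₆ ≤ yV) :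
    let yb : ℝ := (y₁ + y₂ + y₃ + y₄ - y₅ - y₆) / 2
    let ub : ℝ := (u₁ + u₂ + u₃ + u₄ - u₅ - u₆) / 2
    let Sz : ℝ := (u₁ - ub) ^ 2 + (u₂ - ub) ^ 2 + (u₃ - ub) ^ 2 + (u₄ - ub) ^ 2 - ((u₅ - ub) ^ 2 + (u₆ - ub) ^ 2)
    let P2 : ℝ := (y₁ - yb) * (u₁ - ub) ^ 2 + (y₂ - yb) * (u₂ - ub) ^ 2 + (y₃ - yb) * (u₃ - ub) ^ 2
      + (y₄ - yb) * (u₄ - ub) ^ 2 - ((y₅ - yb) * (u₅ - ub) ^ 2 + (y₆ - yb) * (u₆ - ub) ^ 2)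
    let A : ℝ := (y₁ - yV) + (y₂ - yV) + (y₃ - yV) + (y₄ - yV) + (yV - y₅) + (yV - y₆)
    P2 = 0 → 0 ≤ Sz * A := by
  intro yb ub Sz P2 A hP2
  have hid : P2 = (y₁ - yV) * (u₁ - ub) ^ 2 + (y₂ - yV) * (u₂ - ub) ^ 2 + (y₃ - yV) * (u₃ - ub) ^ 2
          + (y₄ - yV) * (u₄ - ub) ^ 2 + (yV - y₅) * (u₅ - ub) ^ 2 + (yV - y₆) * (u₆ - ub) ^ 2 - 1 / 2 * Sz * A := by
    simp only [A, P2, Sz, ub, yb]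
    ring
  have t1 : 0 ≤ (y₁ - yV) * (u₁ - ub) ^ 2 := mul_nonneg (by linarith) (sq_nonneg _)
  have t2 : 0 ≤ (y₂ - yV) * (u₂ - ub) ^ 2 := mul_nonneg (by linarith) (sq_nonneg _)
  have t3 : 0 ≤ (y₃ - yV) * (u₃ - ub) ^ 2 := mul_nonneg (by linarith) (sq_nonneg _)
  have t4 : 0 ≤ (y₄ - yV) * (u₄ - ub) ^ 2 := mul_nonneg (by linarith) (sq_nonneg _)
  have t5 : 0 ≤ (yV - y₅) * (u₅ - ub) ^ 2 := mul_nonneg (by linarith) (sq_nonneg _)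
  have t6 : 0 ≤ (yV - y₆) * (u₆ - ub) ^ 2 := mul_nonneg (by linarith) (sq_nonneg _)
  linarith [t1, t2, t3, t4, t5, t6, hid, hP2]

end Summit.HodgeConjecture.HodgeConjecture.WeilClassTestWallFactorisation
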